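import Literature.Combinatorics.SimpleGraph.HamiltonianLOTFamilies
import HarnessLib

/-!
# The `#3SAT → #HamPath` construction, IIb: the stage-2 family (wires) and its validity

Continuation of `HamiltonianLOTFamilies.lean`. The second family of gadgets is substituted into
the graph `graph₁ φ` obtained from the diamond chain by the stage-1 family (`fam₁`, `valid₁`): per
column `c` and row `r` the five exclusive-or hop ladders `h₀ … h₄` of the wire of column `c`
through the site `(r, J r c)` (slots `hopSlots φ c r h`: the entry slot `above r c`, the hop edges of
the diamond ladder of the site, the door `W.UL`), per column the set ladder (`setSlots φ c`) and the
link into the clause cell (`klinkSlots φ c`) — `n₂ φ = 5N² + 2N` exclusive-or ladders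
(`RailXOR.Γ`, census `[|U| = 1]`) in blocks of 12 vertices from `base2 φ` on (`placed₂`, `fam₂`).

Main result: `valid₂` — **the stage-2 family is valid over `graph₁ φ`**: its slots are chain slot
edges that are NOT stage-1 slots (so still edges of `graph₁`) or hop edges inside the diamond
ladders (edges of `graph₁` by construction); distinct stage-2 gadgets have distinct slots
(`idxOfSlot₂_eq`: a stage-2 slot determines its gadget, through its increasing form `canon`).

**Orientation.** The ORDER of the two ends of a slot decides which end the first rail node of the
exclusive-or ladder is attached to; for the grid drawing (part VI) three slot families must be
attached the other way round than in `HamiltonianLOTLayout.lean`: the entry slot of the first hop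
ladder of every site and of every clause link (`(above r c).swap`, `(below (N-1) c).swap`: the rows
alternate in direction, so the two rails of these vertical ladders lie in mirror-image rows), and
the second slot of every set ladder (`(Br.LL).swap`; at the dummies the vacuous pair is
`D.LR, (D'.LL).swap`). The primed slot functions `hopSlots'`, `setSlots'`, `klinkSlots'` below are
the ones used; `basePair₂` keeps the increasing forms, to which all bookkeeping is reduced by `canon`.

## References

* M. Liśkiewicz, M. Ogihara, S. Toda, TCS 304 (2003) 129–156, §3 (Lemma 4; Fig. 2 (b): the
  crossing exclusive-or line cut into exclusive-or gadgets through the two-node cycles).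
* M. R. Garey, D. S. Johnson, *Computers and Intractability*, Freeman 1979, §3.2.2.
-/

namespace Literature.Combinatorics.SimpleGraph

namespace LOTReduction

open Literature.Computability.Complexity

variable (φ : CNF ℕ)

/-! ### The graph after stage 1 -/

/-- **The graph after the stage-1 substitutions.** [cite: LiskiewiczOgiharaToda2003, §3] -/
noncomputable def graph₁ : _root_.SimpleGraph ℕ :=
  GadgetFamily.graphUpTo (chainG (M φ)) (chainV (M φ)) (fam₁ φ) (n₁ φ)

/-- **Its vertex set.** [folklore] -/
noncomputable def verts₁ : Finset ℕ :=
  GadgetFamily.vertsUpTo (chainV (M φ)) (fam₁ φ) (n₁ φ)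

/-! ### Bounds for the stage-2 slots -/

variable {φ}

/-- `base1 ≤ base2`. [folklore] -/
theorem base1_le_base2 : base1 φ + 24 * (N φ * N φ) ≤ base2 φ := by
  unfold base2 clause1Base; omega

/-- A diamond-ladder block ends below `base2`. [folklore] -/
theorem dlBase_add_lt_base2 {r j : ℕ} (hr : r < N φ) (hj : j < N φ) : dlBase φ r j + 24 ≤ base2 φ := by
  have h1 : r * N φ + j < N φ * N φ := by
    calc r * N φ + j < r * N φ + N φ := by omega
      _ = (r + 1) * N φ := by ring
      _ ≤ N φ * N φ := Nat.mul_le_mul_right _ hr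
  have := base1_le_base2 (φ := φ)
  unfold dlBase; omega

/-- Hop edges go up and end below `base2`. [folklore] -/
theorem hopUL_bounds {r j : ℕ} (hr : r < N φ) (hj : j < N φ) (k : ℕ) (hk : k < 4) :
    (hopUL φ r j k).1 < (hopUL φ r j k).2 ∧ (hopUL φ r j k).2 < base2 φ ∧ base1 φ ≤ (hopUL φ r j k).1 := by
  have := dlBase_add_lt_base2 hr hj
  unfold hopUL dlBase at *; dsimp only; omega

/-- Hop edges go up and end below `base2`. [folklore] -/
theorem hopLL_bounds {r j : ℕ} (hr : r < N φ) (hj : j < N φ) (k : ℕ) (hk : k < 4) :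
    (hopLL φ r j k).1 < (hopLL φ r j k).2 ∧ (hopLL φ r j k).2 < base2 φ ∧ base1 φ ≤ (hopLL φ r j k).1 := by
  have := dlBase_add_lt_base2 hr hj
  unfold hopLL dlBase at *; dsimp only; omega

/-- Cell slots go up and end below `base1 ≤ base2`. [folklore] -/
theorem cellSlot_bounds {k : ℕ} (hk : k < M φ) :
    ((slUL k).1 < (slUL k).2 ∧ (slUL k).2 < base1 φ) ∧ ((slUR k).1 < (slUR k).2 ∧ (slUR k).2 < base1 φ) ∧
      ((slLL k).1 < (slLL k).2 ∧ (slLL k).2 < base1 φ) ∧ ((slLR k).1 < (slLR k).2 ∧ (slLR k).2 < base1 φ) := by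
  unfold slUL slUR slLL slLR base1; dsimp only; omega

/-- `below r c` goes up and ends below `base1`. [folklore] -/
theorem below_bounds {r c : ℕ} (hr : r < N φ) (hc : c < N φ) : (below φ r c).1 < (below φ r c).2 ∧ (below φ r c).2 < base1 φ := by
  have hj := J_lt (r := r) hc
  unfold below
  split_ifs
  · exact (cellSlot_bounds (rowCell_lt_M hr (k := 2 * J φ r c) (by omega))).2.2.2
  · exact (cellSlot_bounds (rowCell_lt_M hr (k := 2 * J φ r c + 1) (by omega))).2.2.1

/-- `above r c` goes up and ends below `base1`. [folklore] -/
theorem above_bounds {r c : ℕ} (hr : r < N φ) (hc : c < N φ) : (above φ r c).1 < (above φ r c).2 ∧ (above φ r c).2 < base1 φ := by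
  unfold above
  split_ifs with h0
  · exact (cellSlot_bounds (dIdx_lt_M hc)).2.2.1
  · exact below_bounds (by omega) hc

/-- The two slots of a hop ladder: both go up, end below `base2`, and have pairwise distinct ends. [folklore] -/
theorem hopSlots_bounds {c r h : ℕ} (hc : c < N φ) (hr : r < N φ) (hh : h < 5) :
    ((hopSlots φ c r h).1.1 < (hopSlots φ c r h).1.2 ∧ (hopSlots φ c r h).1.2 < base2 φ) ∧
      ((hopSlots φ c r h).2.1 < (hopSlots φ c r h).2.2 ∧ (hopSlots φ c r h).2.2 < base2 φ) ∧
      ((hopSlots φ c r h).1.1 ≠ (hopSlots φ c r h).2.1 ∧ (hopSlots φ c r h).1.1 ≠ (hopSlots φ c r h).2.2 ∧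
        (hopSlots φ c r h).1.2 ≠ (hopSlots φ c r h).2.1 ∧ (hopSlots φ c r h).1.2 ≠ (hopSlots φ c r h).2.2) := by
  have hj := J_lt (r := r) hc
  have hb := base1_le_base2 (φ := φ)
  unfold hopSlots
  split_ifs with h0 h4 <;> dsimp only
  · have h1 := above_bounds hr hc
    have h2 := hopUL_bounds hr hj 0 (by omega)
    exact ⟨⟨h1.1, by omega⟩, ⟨h2.1, h2.2.1⟩, by omega, by omega, by omega, by omega⟩
  · have h1 := hopLL_bounds hr hj 3 (by omega)
    have h2 := (cellSlot_bounds (φ := φ) (rowCell_lt_M hr (k := 2 * J φ r c + 1) (by omega))).1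
    unfold wIdx
    exact ⟨⟨h1.1, h1.2.1⟩, ⟨h2.1, by omega⟩, by omega, by omega, by omega, by omega⟩
  · have h1 := hopLL_bounds hr hj (h - 1) (by omega)
    have h2 := hopUL_bounds hr hj h (by omega)
    refine ⟨⟨h1.1, h1.2.1⟩, ⟨h2.1, h2.2.1⟩, ?_⟩
    unfold hopLL hopUL; dsimp only; omega

/-- The two slots of a set ladder. [folklore] -/
theorem setSlots_bounds {c : ℕ} (hc : c < N φ) :
    ((setSlots φ c).1.1 < (setSlots φ c).1.2 ∧ (setSlots φ c).1.2 < base2 φ) ∧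
      ((setSlots φ c).2.1 < (setSlots φ c).2.2 ∧ (setSlots φ c).2.2 < base2 φ) ∧
      ((setSlots φ c).1.1 ≠ (setSlots φ c).2.1 ∧ (setSlots φ c).1.1 ≠ (setSlots φ c).2.2 ∧
        (setSlots φ c).1.2 ≠ (setSlots φ c).2.1 ∧ (setSlots φ c).1.2 ≠ (setSlots φ c).2.2) := by
  have hb := base1_le_base2 (φ := φ)
  have hj := J_lt (r := c) hc
  unfold setSlots
  split_ifs <;> dsimp only
  · have h1 := five_cell_lt_base1 φ (rowCell_lt_M hc (k := 2 * J φ c c + 1) (by omega))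
    have h2 := five_cell_lt_base1 φ (rowCell_lt_M hc (k := 2 * J φ c c + 2) (by omega))
    unfold wIdx brIdx slLL; dsimp only; unfold rowCell at *; omega
  · have h1 := five_cell_lt_base1 φ (dIdx_lt_M hc)
    have h2 := five_cell_lt_base1 φ (d'Idx_lt_M hc)
    unfold dIdx d'Idx slLR slUR at *; dsimp only; omega

/-- The two slots of a clause link. [folklore] -/
theorem klinkSlots_bounds {c : ℕ} (hc : c < N φ) :
    ((klinkSlots φ c).1.1 < (klinkSlots φ c).1.2 ∧ (klinkSlots φ c).1.2 < base2 φ) ∧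
      ((klinkSlots φ c).2.1 < (klinkSlots φ c).2.2 ∧ (klinkSlots φ c).2.2 < base2 φ) ∧
      ((klinkSlots φ c).1.1 ≠ (klinkSlots φ c).2.1 ∧ (klinkSlots φ c).1.1 ≠ (klinkSlots φ c).2.2 ∧
        (klinkSlots φ c).1.2 ≠ (klinkSlots φ c).2.1 ∧ (klinkSlots φ c).1.2 ≠ (klinkSlots φ c).2.2) := by
  have hb := base1_le_base2 (φ := φ)
  have hN : 0 < N φ := by omega
  have h1 := below_bounds (r := N φ - 1) (by omega) hc
  have h2 := (cellSlot_bounds (φ := φ) (kIdx_lt_M hc)).1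
  -- the ends of `below` lie in a row cell, those of `K_c.UL` in a clause cell
  have hlow : (below φ (N φ - 1) c).2 ≤ 5 * rowCell φ (N φ - 1) (2 * N φ) + 4 := by
    have hj := J_lt (r := N φ - 1) hc
    unfold below blIdx wIdx slLR slLL rowCell; split_ifs <;> simp only <;> omega
  have hhigh : 5 * kIdx φ c + 1 = (slUL (kIdx φ c)).1 := by simp [slUL]
  have hsep : rowCell φ (N φ - 1) (2 * N φ) < kIdx φ c := by
    have := rowCell_lt (φ := φ) (r := N φ - 1) (k := 2 * N φ) (by omega) le_rfl
    unfold kIdx; omega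
  unfold klinkSlots
  dsimp only
  have := h1.1; have := h2.1
  refine ⟨⟨h1.1, by omega⟩, ⟨h2.1, by omega⟩, ?_⟩
  omega

/-! ### The slots actually used (three families reversed) -/

variable (φ) in
/-- Slots of the hop ladder `h` of column `c` in row `r`, the entry slot of `h₀` REVERSED (see the
module docstring). [cite: LiskiewiczOgiharaToda2003, §3, Fig. 2 (b)] -/
def hopSlots' (c r h : ℕ) : (ℕ × ℕ) × (ℕ × ℕ) :=
  if h = 0 then ((above φ r c).swap, hopUL φ r (J φ r c) 0) else hopSlots φ c r h

variable (φ) in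
/-- Slots of the set ladder of column `c`, the second one REVERSED: `W.LL – (Br.LL)ᵒᵖ` at site
`(c, J c c)` if the variable occurred before, else the vacuous pair `D_c.LR – (D'_c.LL)ᵒᵖ` (exactly one
of them is used under the pins). [folklore] -/
def setSlots' (c : ℕ) : (ℕ × ℕ) × (ℕ × ℕ) :=
  if (prev? φ c).isSome then (slLL (wIdx φ c (J φ c c)), (slLL (brIdx φ c (J φ c c))).swap)
  else (slLR (dIdx c), (slLL (d'Idx c)).swap)

variable (φ) in
/-- Slots of the link of column `c` into `K_c`, the exit slot REVERSED. [folklore] -/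
def klinkSlots' (c : ℕ) : (ℕ × ℕ) × (ℕ × ℕ) :=
  ((below φ (N φ - 1) c).swap, slUL (kIdx φ c))

/-- The shape of the bounds of a pair of (possibly reversed) slots: distinct ends below `base2`,
the two slots vertex-disjoint. [folklore] -/
def SlotPairOK (φ : CNF ℕ) (p : (ℕ × ℕ) × (ℕ × ℕ)) : Prop :=
  (p.1.1 ≠ p.1.2 ∧ p.1.1 < base2 φ ∧ p.1.2 < base2 φ) ∧ (p.2.1 ≠ p.2.2 ∧ p.2.1 < base2 φ ∧ p.2.2 < base2 φ) ∧
    (p.1.1 ≠ p.2.1 ∧ p.1.1 ≠ p.2.2 ∧ p.1.2 ≠ p.2.1 ∧ p.1.2 ≠ p.2.2)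

/-- Bounds of a pair of increasing slots give `SlotPairOK`, also after reversing the first. [folklore] -/
theorem slotPairOK_of_lt {p : (ℕ × ℕ) × (ℕ × ℕ)}
    (h : (p.1.1 < p.1.2 ∧ p.1.2 < base2 φ) ∧ (p.2.1 < p.2.2 ∧ p.2.2 < base2 φ) ∧
      (p.1.1 ≠ p.2.1 ∧ p.1.1 ≠ p.2.2 ∧ p.1.2 ≠ p.2.1 ∧ p.1.2 ≠ p.2.2)) :
    SlotPairOK φ p ∧ SlotPairOK φ (p.1.swap, p.2) := by
  unfold SlotPairOK; simp only [Prod.fst_swap, Prod.snd_swap]; omega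

/-- Bounds of the hop-ladder slots. [folklore] -/
theorem hopSlots'_ok {c r h : ℕ} (hc : c < N φ) (hr : r < N φ) (hh : h < 5) : SlotPairOK φ (hopSlots' φ c r h) := by
  have hb := hopSlots_bounds hc hr hh
  unfold hopSlots'
  by_cases h0 : h = 0
  · rw [if_pos h0]
    subst h0
    unfold hopSlots at hb
    rw [if_pos rfl] at hb
    exact (slotPairOK_of_lt hb).2
  · rw [if_neg h0]; exact (slotPairOK_of_lt hb).1

/-- Bounds of the set-ladder slots. [folklore] -/
theorem setSlots'_ok {c : ℕ} (hc : c < N φ) : SlotPairOK φ (setSlots' φ c) := by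
  have hb := base1_le_base2 (φ := φ)
  have hj := J_lt (r := c) hc
  unfold setSlots' SlotPairOK
  split_ifs <;> simp only [Prod.fst_swap, Prod.snd_swap]
  · have h1 := five_cell_lt_base1 φ (rowCell_lt_M hc (k := 2 * J φ c c + 1) (by omega))
    have h2 := five_cell_lt_base1 φ (rowCell_lt_M hc (k := 2 * J φ c c + 2) (by omega))
    unfold wIdx brIdx slLL; dsimp only; unfold rowCell at *; omega
  · have h1 := five_cell_lt_base1 φ (dIdx_lt_M hc)
    have h2 := five_cell_lt_base1 φ (d'Idx_lt_M hc)
    unfold dIdx d'Idx slLR slLL at *; dsimp only; omega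

/-- The set-ladder slots are chain slots (all ends below `base1`). [folklore] -/
theorem setSlots'_lt_base1 {c : ℕ} (hc : c < N φ) :
    (setSlots' φ c).1.1 < base1 φ ∧ (setSlots' φ c).1.2 < base1 φ ∧ (setSlots' φ c).2.1 < base1 φ ∧ (setSlots' φ c).2.2 < base1 φ := by
  have hj := J_lt (r := c) hc
  unfold setSlots'
  split_ifs <;> simp only [Prod.fst_swap, Prod.snd_swap]
  · have h1 := five_cell_lt_base1 φ (rowCell_lt_M hc (k := 2 * J φ c c + 1) (by omega))
    have h2 := five_cell_lt_base1 φ (rowCell_lt_M hc (k := 2 * J φ c c + 2) (by omega))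
    unfold wIdx brIdx slLL; dsimp only; omega
  · have h1 := five_cell_lt_base1 φ (dIdx_lt_M hc)
    have h2 := five_cell_lt_base1 φ (d'Idx_lt_M hc)
    unfold slLR slLL; dsimp only; omega

/-- Bounds of the clause-link slots. [folklore] -/
theorem klinkSlots'_ok {c : ℕ} (hc : c < N φ) : SlotPairOK φ (klinkSlots' φ c) := by
  have hb := klinkSlots_bounds hc
  unfold klinkSlots at hb
  exact (slotPairOK_of_lt hb).2

/-- Indices of the hop ladders: `i = 5 (c N + r) + h`. [folklore] -/
theorem hop_idx_lt {i : ℕ} (h : i < 5 * (N φ * N φ)) : i / 5 / N φ < N φ ∧ i / 5 % N φ < N φ ∧ i % 5 < 5 ∧ 0 < N φ := by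
  have hN : 0 < N φ := Nat.pos_of_ne_zero fun h0 => by simp [h0] at h
  exact ⟨Nat.div_lt_of_lt_mul (Nat.div_lt_of_lt_mul h), Nat.mod_lt _ hN, Nat.mod_lt _ (by omega), hN⟩

/-! ### The stage-2 gadgets -/

/-- Placement data of an exclusive-or ladder on two slot edges with distinct ends below `base`
(the slots need not be increasing). [folklore] -/
def xorPlacement' (base : ℕ) (e₁ e₂ : ℕ × ℕ) (h₁ : e₁.1 ≠ e₁.2) (h₂ : e₂.1 ≠ e₂.2) (hb₁ : e₁.1 < base ∧ e₁.2 < base)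
    (hb₂ : e₂.1 < base ∧ e₂.2 < base) (hd : e₁.1 ≠ e₂.1 ∧ e₁.1 ≠ e₂.2 ∧ e₁.2 ≠ e₂.1 ∧ e₁.2 ≠ e₂.2) : RailPlacement where
  k := 2
  K := 4
  m := 4
  Γ := RailXOR.Γ
  base := base
  ends := fun r => if r = 0 then e₁ else e₂
  ends_lt := fun r => by
    by_cases hr : r = 0 <;> simp only [hr, if_true, if_false] <;> omega
  ends_ne := fun r => by
    by_cases hr : r = 0 <;> simp only [hr, if_true, if_false] <;> omega
  ends_distinct := fun r r' hrr' => by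
    have : (r = 0 ∧ r' = 1) ∨ (r = 1 ∧ r' = 0) := by omega
    rcases this with ⟨rfl, rfl⟩ | ⟨rfl, rfl⟩
    · simpa using hd
    · simp only [↓reduceIte, one_ne_zero]
      exact ⟨fun h => hd.1 h.symm, fun h => hd.2.2.1 h.symm, fun h => hd.2.1 h.symm, fun h => hd.2.2.2 h.symm⟩

/-- **A placed exclusive-or ladder** on two slot edges with distinct ends (census `[|U| = 1]`).
[cite: LiskiewiczOgiharaToda2003, §3 (XOR-gadget)] -/
def Placed.ofXOR' (base : ℕ) (p : (ℕ × ℕ) × (ℕ × ℕ)) (h : SlotPairOK φ p) (hb : base2 φ ≤ base) : Placed :=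
  Placed.ofRail (xorPlacement' base p.1 p.2 h.1.1 h.2.1.1 ⟨h.1.2.1.trans_le hb, h.1.2.2.trans_le hb⟩
    ⟨h.2.1.2.1.trans_le hb, h.2.1.2.2.trans_le hb⟩ h.2.2) (by show 0 < 4; omega) RailXOR.exclusive (fun n => n = 1)
    xor_census

variable (φ)

/-- **The slots of stage-2 gadget `i`**: hop ladders (`i = 5 (c N + r) + h`), set ladders
(`i = 5N² + c`), clause links (`i = 5N² + N + c`), with the orientations of the drawing. [folklore] -/
def slotPair₂ (i : ℕ) : (ℕ × ℕ) × (ℕ × ℕ) :=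
  if i < 5 * (N φ * N φ) then hopSlots' φ (i / 5 / N φ) (i / 5 % N φ) (i % 5)
  else if i < 5 * (N φ * N φ) + N φ then setSlots' φ (i - 5 * (N φ * N φ))
  else klinkSlots' φ (i - (5 * (N φ * N φ) + N φ))

/-- The increasing forms of the slots of stage-2 gadget `i` (all bookkeeping is done on these). [folklore] -/
def basePair₂ (i : ℕ) : (ℕ × ℕ) × (ℕ × ℕ) :=
  if i < 5 * (N φ * N φ) then hopSlots φ (i / 5 / N φ) (i / 5 % N φ) (i % 5)
  else if i < 5 * (N φ * N φ) + N φ then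
    (if (prev? φ (i - 5 * (N φ * N φ))).isSome then setSlots φ (i - 5 * (N φ * N φ))
     else (slLR (dIdx (i - 5 * (N φ * N φ))), slLL (d'Idx (i - 5 * (N φ * N φ)))))
  else klinkSlots φ (i - (5 * (N φ * N φ) + N φ))

variable {φ}

/-- The slots of every stage-2 gadget are admissible. [folklore] -/
theorem slotPair₂_ok {i : ℕ} (hi : i < n₂ φ) : SlotPairOK φ (slotPair₂ φ i) := by
  unfold slotPair₂
  split_ifs with h₁ h₂
  · obtain ⟨hc, hr, hh, -⟩ := hop_idx_lt h₁
    exact hopSlots'_ok hc hr hh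
  · exact setSlots'_ok (by omega)
  · exact klinkSlots'_ok (by unfold n₂ at hi; omega)

variable (φ)

/-- **The stage-2 gadget with index `i`.** [cite: LiskiewiczOgiharaToda2003, §3, Fig. 2 (b)] -/
noncomputable def placed₂ (i : ℕ) : Placed :=
  if h : i < n₂ φ then Placed.ofXOR' (base2 φ + 12 * i) (slotPair₂ φ i) (slotPair₂_ok h) (Nat.le_add_right _ _)
  else Placed.empty (totalV φ)

/-- **The stage-2 gadget family.** [cite: LiskiewiczOgiharaToda2003, §3] -/
noncomputable def fam₂ : GadgetFamily ℕ where
  S := fun i => (placed₂ φ i).S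
  GX := fun i => (placed₂ φ i).GX
  VX := fun i => (placed₂ φ i).VX

variable {φ}

/-- The slots of a placed exclusive-or ladder. [folklore] -/
theorem Placed.ofXOR'_S (base : ℕ) (p : (ℕ × ℕ) × (ℕ × ℕ)) (h : SlotPairOK φ p) (hb : base2 φ ≤ base) :
    (Placed.ofXOR' base p h hb).S = {p.1, p.2} := by
  rw [Placed.ofXOR', Placed.ofRail_S]
  ext e
  simp only [Finset.mem_image, Finset.mem_univ, true_and, Finset.mem_insert, Finset.mem_singleton, xorPlacement']
  constructor
  · rintro ⟨r, rfl⟩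
    by_cases hr : r = 0
    · simp [hr]
    · simp [hr]
  · rintro (rfl | rfl)
    · exact ⟨0, by simp⟩
    · exact ⟨1, by simp⟩

/-- The block of a placed exclusive-or ladder. [folklore] -/
theorem Placed.ofXOR'_lo_size (base : ℕ) (p : (ℕ × ℕ) × (ℕ × ℕ)) (h : SlotPairOK φ p) (hb : base2 φ ≤ base) :
    (Placed.ofXOR' base p h hb).lo = base ∧ (Placed.ofXOR' base p h hb).size = 12 :=
  ⟨rfl, rfl⟩

/-- **The slots of stage-2 gadget `i < n₂`.** [folklore] -/
theorem placed₂_S {i : ℕ} (hi : i < n₂ φ) : (placed₂ φ i).S = {(slotPair₂ φ i).1, (slotPair₂ φ i).2} := by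
  unfold placed₂
  rw [dif_pos hi]
  exact Placed.ofXOR'_S _ _ _ _

/-- The block of stage-2 gadget `i < n₂`. [folklore] -/
theorem placed₂_lo {i : ℕ} (hi : i < n₂ φ) : (placed₂ φ i).lo = base2 φ + 12 * i ∧ (placed₂ φ i).size = 12 := by
  unfold placed₂
  rw [dif_pos hi]
  exact Placed.ofXOR'_lo_size _ _ _ _

/-- Both increasing forms of the slots of stage-2 gadget `i < n₂` go up and end below `base2`. [folklore] -/
theorem basePair₂_bounds {i : ℕ} (hi : i < n₂ φ) :
    ((basePair₂ φ i).1.1 < (basePair₂ φ i).1.2 ∧ (basePair₂ φ i).1.2 < base2 φ) ∧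
      ((basePair₂ φ i).2.1 < (basePair₂ φ i).2.2 ∧ (basePair₂ φ i).2.2 < base2 φ) := by
  unfold basePair₂
  split_ifs with h₁ h₂ h₃
  · obtain ⟨hc, hr, hh, -⟩ := hop_idx_lt h₁
    have h := hopSlots_bounds hc hr hh
    exact ⟨h.1, h.2.1⟩
  · have h := setSlots_bounds (φ := φ) (c := i - 5 * (N φ * N φ)) (by omega)
    exact ⟨h.1, h.2.1⟩
  · have hc : i - 5 * (N φ * N φ) < N φ := by omega
    have hb := base1_le_base2 (φ := φ)
    dsimp only
    exact ⟨⟨(cellSlot_bounds (dIdx_lt_M hc)).2.2.2.1, by have := (cellSlot_bounds (dIdx_lt_M hc)).2.2.2.2; omega⟩,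
      ⟨(cellSlot_bounds (d'Idx_lt_M hc)).2.2.1.1, by have := (cellSlot_bounds (d'Idx_lt_M hc)).2.2.1.2; omega⟩⟩
  · have h := klinkSlots_bounds (φ := φ) (c := i - (5 * (N φ * N φ) + N φ)) (by unfold n₂ at hi; omega)
    exact ⟨h.1, h.2.1⟩

/-- **The increasing form** of a pair of distinct vertices. [folklore] -/
def canon (e : ℕ × ℕ) : ℕ × ℕ := if e.1 < e.2 then e else e.swap

/-- `canon` of an increasing pair. [folklore] -/
theorem canon_of_lt {e : ℕ × ℕ} (h : e.1 < e.2) : canon e = e := if_pos h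

/-- `canon` of a decreasing pair. [folklore] -/
theorem canon_of_gt {e : ℕ × ℕ} (h : e.2 < e.1) : canon e = e.swap := if_neg (by omega)

/-- `canon` is invariant under reversal. [folklore] -/
theorem canon_swap {e : ℕ × ℕ} (h : e.1 ≠ e.2) : canon e.swap = canon e := by
  unfold canon
  simp only [Prod.fst_swap, Prod.snd_swap, Prod.swap_swap]
  split_ifs <;> first | rfl | omega

/-- `canon e` is `e` or its reversal. [folklore] -/
theorem canon_eq_or (e : ℕ × ℕ) : canon e = e ∨ canon e = e.swap := by
  unfold canon; split_ifs <;> simp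

/-- **The increasing forms of the slots used are the base pairs.** [folklore] -/
theorem canon_slotPair₂ {i : ℕ} (hi : i < n₂ φ) :
    canon (slotPair₂ φ i).1 = (basePair₂ φ i).1 ∧ canon (slotPair₂ φ i).2 = (basePair₂ φ i).2 := by
  have hb := basePair₂_bounds hi
  revert hb
  unfold slotPair₂ basePair₂ hopSlots' setSlots'
  split_ifs with h₁ h₀ h₂ hp <;> intro hb
  · -- `h₀`
    have hb0 : (hopSlots φ (i / 5 / N φ) (i / 5 % N φ) (i % 5)).1 = above φ (i / 5 % N φ) (i / 5 / N φ) := by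
      unfold hopSlots; rw [if_pos h₀]
    have hb1 : (hopSlots φ (i / 5 / N φ) (i / 5 % N φ) (i % 5)).2 = hopUL φ (i / 5 % N φ) (J φ (i / 5 % N φ) (i / 5 / N φ)) 0 := by
      unfold hopSlots; rw [if_pos h₀]
    rw [hb0] at hb ⊢; rw [hb1] at hb ⊢
    dsimp only
    exact ⟨by rw [canon_of_gt (by simpa using hb.1.1), Prod.swap_swap], canon_of_lt hb.2.1⟩
  · exact ⟨canon_of_lt hb.1.1, canon_of_lt hb.2.1⟩
  · unfold setSlots at hb ⊢
    rw [if_pos hp] at hb ⊢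
    dsimp only at hb ⊢
    exact ⟨canon_of_lt hb.1.1, by rw [canon_of_gt (by simpa using hb.2.1), Prod.swap_swap]⟩
  · dsimp only at hb ⊢
    exact ⟨canon_of_lt hb.1.1, by rw [canon_of_gt (by simpa using hb.2.1), Prod.swap_swap]⟩
  · unfold klinkSlots'
    unfold klinkSlots at hb ⊢
    dsimp only at hb ⊢
    exact ⟨by rw [canon_of_gt (by simpa using hb.1.1), Prod.swap_swap], canon_of_lt hb.2.1⟩

/-! ### The kinds of stage-2 slots -/

/-- **A description of every stage-2 slot.** [folklore] -/
inductive Slot2Kind (φ : CNF ℕ) : ℕ × ℕ → Prop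
  | dLL (c : ℕ) (hc : c < N φ) : Slot2Kind φ (slLL (dIdx c))
  | dLR (c : ℕ) (hc : c < N φ) : Slot2Kind φ (slLR (dIdx c))
  | d'LL (c : ℕ) (hc : c < N φ) : Slot2Kind φ (slLL (d'Idx c))
  | bLR (r j : ℕ) (hr : r < N φ) (hj : j < N φ) : Slot2Kind φ (slLR (blIdx φ r j))
  | wLL (r j : ℕ) (hr : r < N φ) (hj : j < N φ) : Slot2Kind φ (slLL (wIdx φ r j))
  | wUL (r j : ℕ) (hr : r < N φ) (hj : j < N φ) : Slot2Kind φ (slUL (wIdx φ r j))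
  | brLL (r j : ℕ) (hr : r < N φ) (hj : j < N φ) : Slot2Kind φ (slLL (brIdx φ r j))
  | kUL (c : ℕ) (hc : c < N φ) : Slot2Kind φ (slUL (kIdx φ c))
  | hUL (r j k : ℕ) (hr : r < N φ) (hj : j < N φ) (hk : k < 4) : Slot2Kind φ (hopUL φ r j k)
  | hLL (r j k : ℕ) (hr : r < N φ) (hj : j < N φ) (hk : k < 4) : Slot2Kind φ (hopLL φ r j k)

/-- `below r c` has a stage-2 kind. [folklore] -/
theorem slot2Kind_below {r c : ℕ} (hr : r < N φ) (hc : c < N φ) : Slot2Kind φ (below φ r c) := by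
  unfold below; split_ifs
  exacts [Slot2Kind.bLR _ _ hr (J_lt hc), Slot2Kind.wLL _ _ hr (J_lt hc)]

/-- `above r c` has a stage-2 kind. [folklore] -/
theorem slot2Kind_above {r c : ℕ} (hr : r < N φ) (hc : c < N φ) : Slot2Kind φ (above φ r c) := by
  unfold above; split_ifs with h0
  exacts [Slot2Kind.dLL _ hc, slot2Kind_below (by omega) hc]

/-- Both base pairs of a stage-2 gadget have a stage-2 kind. [folklore] -/
theorem slot2Kind_basePair₂ {i : ℕ} (hi : i < n₂ φ) :
    Slot2Kind φ (basePair₂ φ i).1 ∧ Slot2Kind φ (basePair₂ φ i).2 := by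
  unfold basePair₂
  split_ifs with h₁ h₂ h₃
  · obtain ⟨hc, hr, -, -⟩ := hop_idx_lt h₁
    have hj := J_lt (r := i / 5 % N φ) hc
    unfold hopSlots
    split_ifs with h0 h4
    · exact ⟨slot2Kind_above hr hc, Slot2Kind.hUL _ _ _ hr hj (by omega)⟩
    · exact ⟨Slot2Kind.hLL _ _ _ hr hj (by omega), Slot2Kind.wUL _ _ hr hj⟩
    · exact ⟨Slot2Kind.hLL _ _ _ hr hj (by omega), Slot2Kind.hUL _ _ _ hr hj (by omega)⟩
  · have hc : i - 5 * (N φ * N φ) < N φ := by omega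
    unfold setSlots
    rw [if_pos h₃]
    exact ⟨Slot2Kind.wLL _ _ hc (J_lt hc), Slot2Kind.brLL _ _ hc (J_lt hc)⟩
  · have hc : i - 5 * (N φ * N φ) < N φ := by omega
    exact ⟨Slot2Kind.dLR _ hc, Slot2Kind.d'LL _ hc⟩
  · have hc : i - (5 * (N φ * N φ) + N φ) < N φ := by unfold n₂ at hi; omega
    unfold klinkSlots
    exact ⟨slot2Kind_below (by omega) hc, Slot2Kind.kUL _ hc⟩

/-- **A stage-2 slot is a chain slot edge of a cell below `M`, or a hop edge.** [folklore] -/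
theorem Slot2Kind.chain_or_hop {e : ℕ × ℕ} (h : Slot2Kind φ e) :
    (e.1 ∈ chainV (M φ) ∧ e.2 ∈ chainV (M φ) ∧ (chainG (M φ)).Adj e.1 e.2 ∧ e.2 < base1 φ) ∨
      ∃ r j, r < N φ ∧ j < N φ ∧ e ∈ (placed₁ φ (r * N φ + j)).H := by
  cases h with
  | dLL c hc => have hk := dIdx_lt_M hc; exact Or.inl ⟨(slLL_mem hk).1, (slLL_mem hk).2, chainG_adj_slLL hk, (cellSlot_bounds hk).2.2.1.2⟩
  | dLR c hc => have hk := dIdx_lt_M hc; exact Or.inl ⟨(slLR_mem hk).1, (slLR_mem hk).2, chainG_adj_slLR hk, (cellSlot_bounds hk).2.2.2.2⟩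
  | d'LL c hc => have hk := d'Idx_lt_M hc; exact Or.inl ⟨(slLL_mem hk).1, (slLL_mem hk).2, chainG_adj_slLL hk, (cellSlot_bounds hk).2.2.1.2⟩
  | bLR r j hr hj =>
    have hk := rowCell_lt_M hr (k := 2 * j) (by omega)
    exact Or.inl ⟨(slLR_mem hk).1, (slLR_mem hk).2, chainG_adj_slLR hk, (cellSlot_bounds hk).2.2.2.2⟩
  | wLL r j hr hj =>
    have hk := rowCell_lt_M hr (k := 2 * j + 1) (by omega)
    exact Or.inl ⟨(slLL_mem hk).1, (slLL_mem hk).2, chainG_adj_slLL hk, (cellSlot_bounds hk).2.2.1.2⟩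
  | wUL r j hr hj =>
    have hk := rowCell_lt_M hr (k := 2 * j + 1) (by omega)
    exact Or.inl ⟨(slUL_mem hk).1, (slUL_mem hk).2, chainG_adj_slUL hk, (cellSlot_bounds hk).1.2⟩
  | brLL r j hr hj =>
    have hk := rowCell_lt_M hr (k := 2 * j + 2) (by omega)
    exact Or.inl ⟨(slLL_mem hk).1, (slLL_mem hk).2, chainG_adj_slLL hk, (cellSlot_bounds hk).2.2.1.2⟩
  | kUL c hc => have hk := kIdx_lt_M hc; exact Or.inl ⟨(slUL_mem hk).1, (slUL_mem hk).2, chainG_adj_slUL hk, (cellSlot_bounds hk).1.2⟩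
  | hUL r j k hr hj hk =>
    refine Or.inr ⟨r, j, hr, hj, ?_⟩
    have hidx : r * N φ + j < N φ * N φ := by
      calc r * N φ + j < r * N φ + N φ := by omega
        _ = (r + 1) * N φ := by ring
        _ ≤ N φ * N φ := Nat.mul_le_mul_right _ hr
    have hd : (r * N φ + j) / N φ = r := by
      rw [Nat.add_comm, Nat.add_mul_div_right _ _ (by omega), Nat.div_eq_of_lt hj]; simp
    have hm : (r * N φ + j) % N φ = j := by
      rw [Nat.add_comm, Nat.add_mul_mod_self_right, Nat.mod_eq_of_lt hj]
    unfold placed₁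
    rw [dif_pos hidx]
    show hopUL φ r j k ∈ (dlPlacement _ _ _ _ _ _ _ _).H
    rw [DLPlacement.mem_H_iff]
    refine ⟨⟨k, hk⟩, Or.inl ?_⟩
    simp only [DLPlacement.UL, dlPlacement, hd, hm, hopUL]
  | hLL r j k hr hj hk =>
    refine Or.inr ⟨r, j, hr, hj, ?_⟩
    have hidx : r * N φ + j < N φ * N φ := by
      calc r * N φ + j < r * N φ + N φ := by omega
        _ = (r + 1) * N φ := by ring
        _ ≤ N φ * N φ := Nat.mul_le_mul_right _ hr
    have hd : (r * N φ + j) / N φ = r := by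
      rw [Nat.add_comm, Nat.add_mul_div_right _ _ (by omega), Nat.div_eq_of_lt hj]; simp
    have hm : (r * N φ + j) % N φ = j := by
      rw [Nat.add_comm, Nat.add_mul_mod_self_right, Nat.mod_eq_of_lt hj]
    unfold placed₁
    rw [dif_pos hidx]
    show hopLL φ r j k ∈ (dlPlacement _ _ _ _ _ _ _ _).H
    rw [DLPlacement.mem_H_iff]
    refine ⟨⟨k, hk⟩, Or.inr ?_⟩
    simp only [DLPlacement.LL, dlPlacement, hd, hm, hopLL]

/-- **No stage-2 chain slot is a stage-1 slot, in either orientation.** [folklore] -/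
theorem Slot2Kind.ne_slot1 {e : ℕ × ℕ} (h : Slot2Kind φ e) (hch : e.2 < base1 φ) {e' : ℕ × ℕ} (h' : Slot1Kind φ e') :
    e' ≠ e ∧ e' ≠ (e.2, e.1) := by
  have hb : ∀ {r j k : ℕ}, r < N φ → j < N φ → k < 4 → base1 φ ≤ (hopUL φ r j k).2 ∧ base1 φ ≤ (hopLL φ r j k).2 := by
    intro r j k _ _ _; unfold hopUL hopLL dlBase; simp only; omega
  cases h with
  | hUL r j k hr hj hk => exact absurd hch (not_lt.2 (hb hr hj hk).1)
  | hLL r j k hr hj hk => exact absurd hch (not_lt.2 (hb hr hj hk).2)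
  | dLL c hc =>
    cases h' with
    | blUR r' j' _ _ => simp [slUR, slLL, Prod.ext_iff]; omega
    | brUL r' j' _ _ => simp [slULrev, slLL, Prod.ext_iff]; omega
    | pin d hd => simp [slUL, slLL, Prod.ext_iff]; omega
    | lit c' hc' =>
      have := le_kIdx (φ := φ) c'
      have h2 := dIdx_lt (φ := φ) hc
      unfold litSlot dIdx at *; split_ifs <;> simp [slLL, slLR, Prod.ext_iff] <;> omega
  | dLR c hc =>
    cases h' with
    | blUR r' j' _ _ => simp [slUR, slLR, Prod.ext_iff]; omega
    | brUL r' j' _ _ => simp [slULrev, slLR, Prod.ext_iff]; omega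
    | pin d hd => simp [slUL, slLR, Prod.ext_iff]; omega
    | lit c' hc' =>
      have := le_kIdx (φ := φ) c'
      have h2 := dIdx_lt (φ := φ) hc
      unfold litSlot dIdx at *; split_ifs <;> simp [slLL, slLR, Prod.ext_iff] <;> omega
  | d'LL c hc =>
    cases h' with
    | blUR r' j' _ _ => simp [slUR, slLL, Prod.ext_iff]; omega
    | brUL r' j' _ _ => simp [slULrev, slLL, Prod.ext_iff]; omega
    | pin d hd => simp [slUL, slLL, Prod.ext_iff]; omega
    | lit c' hc' =>
      have := le_kIdx (φ := φ) c'
      have h2 := d'Idx_lt (φ := φ) hc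
      unfold litSlot d'Idx at *; split_ifs <;> simp [slLL, slLR, Prod.ext_iff] <;> omega
  | bLR r j hr hj =>
    cases h' with
    | blUR r' j' _ _ => simp [slUR, slLR, Prod.ext_iff]; omega
    | brUL r' j' _ _ => simp [slULrev, slLR, Prod.ext_iff]; omega
    | pin d hd => simp [slUL, slLR, Prod.ext_iff]; omega
    | lit c' hc' =>
      have := le_kIdx (φ := φ) c'
      have h2 := rowCell_lt hr (k := 2 * j) (by omega)
      unfold litSlot blIdx at *; split_ifs <;> simp [slLL, slLR, Prod.ext_iff] <;> omega
  | wLL r j hr hj =>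
    cases h' with
    | blUR r' j' _ _ => simp [slUR, slLL, Prod.ext_iff]; omega
    | brUL r' j' _ _ => simp [slULrev, slLL, Prod.ext_iff]; omega
    | pin d hd => simp [slUL, slLL, Prod.ext_iff]; omega
    | lit c' hc' =>
      have := le_kIdx (φ := φ) c'
      have h2 := rowCell_lt hr (k := 2 * j + 1) (by omega)
      unfold litSlot wIdx at *; split_ifs <;> simp [slLL, slLR, Prod.ext_iff] <;> omega
  | wUL r j hr hj =>
    cases h' with
    | blUR r' j' _ _ => simp [slUR, slUL, Prod.ext_iff]; omega
    | brUL r' j' hr' hj' =>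
      -- same shape reversed: `UL` of the door `W = rowCell r (2j+1)` vs `Br = rowCell r' (2j'+2)`: parities differ
      refine ⟨by simp [slULrev, slUL, Prod.ext_iff]; omega, fun heq => ?_⟩
      simp only [slULrev, slUL, Prod.ext_iff] at heq
      have hcell : brIdx φ r' j' = wIdx φ r j := by omega
      unfold brIdx wIdx at hcell
      exact absurd (rowCell_inj (by omega) (by omega) hcell).2 (by omega)
    | pin d hd =>
      have := le_rowCell (φ := φ) r (2 * j + 1)
      unfold wIdx; simp [slUL, Prod.ext_iff]; omega
    | lit c' hc' =>
      have := le_kIdx (φ := φ) c'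
      have h2 := rowCell_lt hr (k := 2 * j + 1) (by omega)
      unfold litSlot wIdx at *; split_ifs <;> simp [slUL, slLL, slLR, Prod.ext_iff] <;> omega
  | brLL r j hr hj =>
    cases h' with
    | blUR r' j' _ _ => simp [slUR, slLL, Prod.ext_iff]; omega
    | brUL r' j' _ _ => simp [slULrev, slLL, Prod.ext_iff]; omega
    | pin d hd => simp [slUL, slLL, Prod.ext_iff]; omega
    | lit c' hc' =>
      have := le_kIdx (φ := φ) c'
      have h2 := rowCell_lt hr (k := 2 * j + 2) (by omega)
      unfold litSlot brIdx at *; split_ifs <;> simp [slLL, slLR, Prod.ext_iff] <;> omega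
  | kUL c hc =>
    cases h' with
    | blUR r' j' _ _ => simp [slUR, slUL, Prod.ext_iff]; omega
    | brUL r' j' hr' hj' =>
      refine ⟨by simp [slULrev, slUL, Prod.ext_iff]; omega, fun heq => ?_⟩
      simp only [slULrev, slUL, Prod.ext_iff] at heq
      have := rowCell_lt hr' (k := 2 * j' + 2) (by omega)
      have h2 := le_kIdx (φ := φ) c
      unfold brIdx at heq; omega
    | pin d hd =>
      have := le_kIdx (φ := φ) c
      simp [slUL, Prod.ext_iff]; omega
    | lit c' hc' => unfold litSlot; split_ifs <;> simp [slUL, slLL, slLR, Prod.ext_iff] <;> omega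

/-! ### Recovering the stage-2 gadget from one of its slots -/

variable (φ) in
/-- The owner of a `below r c`-type slot (tap `Bl.LR` or door exit `W.LL` of row `r`, column `c`):
the entry ladder of the next row, or the clause link if `r` is the last row. [folklore] -/
def nextOwner (r c : ℕ) : ℕ :=
  if r + 1 < N φ then 5 * (c * N φ + (r + 1)) else 5 * (N φ * N φ) + N φ + c

variable (φ) in
/-- **The index of the stage-2 gadget owning a slot edge** (junk off the slots). [folklore] -/
def idxOfSlot₂ (e : ℕ × ℕ) : ℕ :=
  if base1 φ ≤ e.1 then
    -- a hop edge of `DL(r, j)`: block `t = r N + j`, offset `8 + 4k` (`UL`: `e.2 = e.1 + 1`, `LL`: `+ 2`)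
    let B := e.1 - base1 φ
    let t := B / 24
    let k := (B % 24 - 8) / 4
    let r := t / N φ
    let j := t % N φ
    5 * (J φ r j * N φ + r) + (if e.2 = e.1 + 1 then k else k + 1)
  else
    let cell := e.1 / 5
    if cell < 2 * N φ then
      if cell % 2 = 0 ∧ e.2 % 5 = 3 then 5 * (cell / 2 * N φ) else 5 * (N φ * N φ) + cell / 2
    else if cell < 2 * N φ + N φ * (2 * N φ + 1) then
      let r := (cell - 2 * N φ) / (2 * N φ + 1)
      let pos := (cell - 2 * N φ) % (2 * N φ + 1)
      if pos % 2 = 0 then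
        -- a bus cell `B_{r, pos/2}`: `LR` = tap of site `pos/2`; `LL` = `Br.LL` of the set ladder of row `r`
        if e.1 % 5 = 3 then nextOwner φ r (J φ r (pos / 2)) else 5 * (N φ * N φ) + r
      else
        -- the door `W_{r, j}`, `j = pos / 2`: `UL` = `h₄`; `LL` = set ladder of row `r` (at `j = J r r`) or door exit
        if e.2 % 5 = 2 then 5 * (J φ r (pos / 2) * N φ + r) + 4
        else if pos / 2 = J φ r r then 5 * (N φ * N φ) + r else nextOwner φ r (J φ r (pos / 2))
    else 5 * (N φ * N φ) + N φ + (cell - (2 * N φ + N φ * (2 * N φ + 1)))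

/-! ### Evaluating `idxOfSlot₂` on every kind of stage-2 slot -/

/-- `idxOfSlot₂` on a slot of a row cell `rowCell r k` with end offsets `a, b`. [folklore] -/
theorem idxOfSlot₂_rowCell {r k a b : ℕ} (hr : r < N φ) (hk : k ≤ 2 * N φ) (ha : a < 5) (hb : b < 5) :
    idxOfSlot₂ φ (5 * rowCell φ r k + a, 5 * rowCell φ r k + b) =
      if k % 2 = 0 then (if a = 3 then nextOwner φ r (J φ r (k / 2)) else 5 * (N φ * N φ) + r)
      else if b = 2 then 5 * (J φ r (k / 2) * N φ + r) + 4
        else if k / 2 = J φ r r then 5 * (N φ * N φ) + r else nextOwner φ r (J φ r (k / 2)) := by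
  have hlo := le_rowCell (φ := φ) r k
  have hhi := rowCell_lt hr hk
  have hM := five_cell_lt_base1 φ (rowCell_lt_M hr hk)
  obtain ⟨hq, hrem⟩ := rowCell_div_mod (φ := φ) (r := r) (k := k) hk
  have h5 : (5 * rowCell φ r k + a) / 5 = rowCell φ r k := by omega
  have ha5 : (5 * rowCell φ r k + a) % 5 = a := by omega
  have hb5 : (5 * rowCell φ r k + b) % 5 = b := by omega
  unfold idxOfSlot₂
  dsimp only
  rw [if_neg (by omega), h5, if_neg (by omega), if_pos hhi, hq, hrem, ha5, hb5]

/-- `idxOfSlot₂` on a slot of a dummy cell `d < 2N` with end offsets `a, b`. [folklore] -/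
theorem idxOfSlot₂_dummy {d a b : ℕ} (hd : d < 2 * N φ) (ha : a < 5) (hb : b < 5) :
    idxOfSlot₂ φ (5 * d + a, 5 * d + b) = if d % 2 = 0 ∧ b = 3 then 5 * (d / 2 * N φ) else 5 * (N φ * N φ) + d / 2 := by
  have hM := five_cell_lt_base1 φ (show d < M φ by unfold M; omega)
  have h5 : (5 * d + a) / 5 = d := by omega
  have hb5 : (5 * d + b) % 5 = b := by omega
  unfold idxOfSlot₂
  dsimp only
  rw [if_neg (by omega), h5, if_pos hd, hb5]

/-- `idxOfSlot₂` on a slot of a clause cell `K_c` with end offsets `a, b`. [folklore] -/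
theorem idxOfSlot₂_clause {c a : ℕ} (b : ℕ) (hc : c < N φ) (ha : a < 5) :
    idxOfSlot₂ φ (5 * kIdx φ c + a, 5 * kIdx φ c + b) = 5 * (N φ * N φ) + N φ + c := by
  have hM := five_cell_lt_base1 φ (kIdx_lt_M hc)
  have hle := le_kIdx (φ := φ) c
  have h5 : (5 * kIdx φ c + a) / 5 = kIdx φ c := by omega
  unfold idxOfSlot₂
  dsimp only
  rw [if_neg (by omega), h5]
  unfold kIdx
  rw [if_neg (by omega), if_neg (by omega)]
  omega

/-- `idxOfSlot₂` on an upper hop edge. [folklore] -/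
theorem idxOfSlot₂_hopUL {r j k : ℕ} (hj : j < N φ) (hk : k < 4) :
    idxOfSlot₂ φ (hopUL φ r j k) = 5 * (J φ r j * N φ + r) + k := by
  have hd : (r * N φ + j) / N φ = r := by
    rw [Nat.add_comm, Nat.add_mul_div_right _ _ (by omega), Nat.div_eq_of_lt hj]; simp
  have hm : (r * N φ + j) % N φ = j := by
    rw [Nat.add_comm, Nat.add_mul_mod_self_right, Nat.mod_eq_of_lt hj]
  have hB : (dlBase φ r j + (8 + 4 * k) - base1 φ) / 24 = r * N φ + j := by unfold dlBase; omega
  have hK : ((dlBase φ r j + (8 + 4 * k) - base1 φ) % 24 - 8) / 4 = k := by unfold dlBase; omega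
  unfold idxOfSlot₂ hopUL
  dsimp only
  rw [if_pos (by unfold dlBase; omega), hB, hK, hd, hm, if_pos (by omega)]

/-- `idxOfSlot₂` on a lower hop edge. [folklore] -/
theorem idxOfSlot₂_hopLL {r j k : ℕ} (hj : j < N φ) (hk : k < 4) :
    idxOfSlot₂ φ (hopLL φ r j k) = 5 * (J φ r j * N φ + r) + (k + 1) := by
  have hd : (r * N φ + j) / N φ = r := by
    rw [Nat.add_comm, Nat.add_mul_div_right _ _ (by omega), Nat.div_eq_of_lt hj]; simp
  have hm : (r * N φ + j) % N φ = j := by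
    rw [Nat.add_comm, Nat.add_mul_mod_self_right, Nat.mod_eq_of_lt hj]
  have hB : (dlBase φ r j + (8 + 4 * k) - base1 φ) / 24 = r * N φ + j := by unfold dlBase; omega
  have hK : ((dlBase φ r j + (8 + 4 * k) - base1 φ) % 24 - 8) / 4 = k := by unfold dlBase; omega
  unfold idxOfSlot₂ hopLL
  dsimp only
  rw [if_pos (by unfold dlBase; omega), hB, hK, hd, hm, if_neg (by omega)]

/-- `idxOfSlot₂` on the slot `below r c`: the owner is the next hop of column `c` (or its clause link). [folklore] -/
theorem idxOfSlot₂_below {r c : ℕ} (hr : r < N φ) (hc : c < N φ) : idxOfSlot₂ φ (below φ r c) = nextOwner φ r c := by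
  have hj := J_lt (r := r) hc
  have h2 : 2 * J φ r c / 2 = J φ r c := by omega
  have h2' : (2 * J φ r c + 1) / 2 = J φ r c := by omega
  unfold below
  split_ifs with ht
  · show idxOfSlot₂ φ (5 * rowCell φ r (2 * J φ r c) + 3, 5 * rowCell φ r (2 * J φ r c) + 4) = _
    rw [idxOfSlot₂_rowCell hr (by omega) (by omega) (by omega), if_pos (by omega), if_pos rfl, h2, J_J hc]
  · show idxOfSlot₂ φ (5 * rowCell φ r (2 * J φ r c + 1) + 1, 5 * rowCell φ r (2 * J φ r c + 1) + 3) = _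
    rw [idxOfSlot₂_rowCell hr (by omega) (by omega) (by omega), if_neg (by omega), if_neg (by omega), h2', J_J hc,
      if_neg (fun hJ => ht (Or.inl (J_inj hc hr hJ).symm))]

/-- `idxOfSlot₂` on the slot `above r c`: the owner is the entry hop `h₀` of column `c` in row `r`. [folklore] -/
theorem idxOfSlot₂_above {r c : ℕ} (hr : r < N φ) (hc : c < N φ) : idxOfSlot₂ φ (above φ r c) = 5 * (c * N φ + r) := by
  unfold above
  split_ifs with h0
  · subst h0
    show idxOfSlot₂ φ (5 * dIdx c + 1, 5 * dIdx c + 3) = _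
    rw [idxOfSlot₂_dummy (dIdx_lt hc) (by omega) (by omega), if_pos ⟨by unfold dIdx; omega, rfl⟩]
    unfold dIdx; rw [Nat.mul_div_cancel_left c (by omega : 0 < 2)]; omega
  · rw [idxOfSlot₂_below (by omega) hc]
    unfold nextOwner
    rw [if_pos (by omega)]
    omega

/-- `idxOfSlot₂` on the door slot `W.UL` of site `(r, j)`: the owner is `h₄`. [folklore] -/
theorem idxOfSlot₂_wUL {r j : ℕ} (hr : r < N φ) (hj : j < N φ) :
    idxOfSlot₂ φ (slUL (wIdx φ r j)) = 5 * (J φ r j * N φ + r) + 4 := by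
  have h2 : (2 * j + 1) / 2 = j := by omega
  show idxOfSlot₂ φ (5 * rowCell φ r (2 * j + 1) + 1, 5 * rowCell φ r (2 * j + 1) + 2) = _
  rw [idxOfSlot₂_rowCell hr (by omega) (by omega) (by omega), if_neg (by omega), if_pos rfl, h2]

/-- `idxOfSlot₂` on the two slots of the set ladder of column `c`. [folklore] -/
theorem idxOfSlot₂_setSlots {c : ℕ} (hc : c < N φ) :
    idxOfSlot₂ φ (setSlots φ c).1 = 5 * (N φ * N φ) + c ∧ idxOfSlot₂ φ (setSlots φ c).2 = 5 * (N φ * N φ) + c := by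
  have hj := J_lt (r := c) hc
  have h2 : (2 * J φ c c + 1) / 2 = J φ c c := by omega
  unfold setSlots
  split_ifs with hp <;> dsimp only
  · constructor
    · show idxOfSlot₂ φ (5 * rowCell φ c (2 * J φ c c + 1) + 1, 5 * rowCell φ c (2 * J φ c c + 1) + 3) = _
      rw [idxOfSlot₂_rowCell hc (by omega) (by omega) (by omega), if_neg (by omega), if_neg (by omega), if_pos h2]
    · show idxOfSlot₂ φ (5 * rowCell φ c (2 * J φ c c + 2) + 1, 5 * rowCell φ c (2 * J φ c c + 2) + 3) = _
      rw [idxOfSlot₂_rowCell hc (by omega) (by omega) (by omega), if_pos (by omega), if_neg (by omega)]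
  · constructor
    · show idxOfSlot₂ φ (5 * dIdx c + 3, 5 * dIdx c + 4) = _
      rw [idxOfSlot₂_dummy (dIdx_lt hc) (by omega) (by omega), if_neg (by omega)]
      unfold dIdx; omega
    · show idxOfSlot₂ φ (5 * d'Idx c + 2, 5 * d'Idx c + 4) = _
      rw [idxOfSlot₂_dummy (d'Idx_lt hc) (by omega) (by omega), if_neg (by omega)]
      unfold d'Idx; omega

/-- `idxOfSlot₂` on the vacuous second set slot `D'_c.LL`. [folklore] -/
theorem idxOfSlot₂_d'LL {c : ℕ} (hc : c < N φ) : idxOfSlot₂ φ (slLL (d'Idx c)) = 5 * (N φ * N φ) + c := by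
  show idxOfSlot₂ φ (5 * d'Idx c + 1, 5 * d'Idx c + 3) = _
  rw [idxOfSlot₂_dummy (d'Idx_lt hc) (by omega) (by omega), if_neg (by unfold d'Idx; omega)]
  unfold d'Idx; omega

/-- `idxOfSlot₂` on the two slots of the clause link of column `c`. [folklore] -/
theorem idxOfSlot₂_klinkSlots {c : ℕ} (hc : c < N φ) :
    idxOfSlot₂ φ (klinkSlots φ c).1 = 5 * (N φ * N φ) + N φ + c ∧
      idxOfSlot₂ φ (klinkSlots φ c).2 = 5 * (N φ * N φ) + N φ + c := by
  unfold klinkSlots; dsimp only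
  constructor
  · rw [idxOfSlot₂_below (by omega) hc]
    unfold nextOwner
    rw [if_neg (by omega)]
  · show idxOfSlot₂ φ (5 * kIdx φ c + 1, 5 * kIdx φ c + 2) = _
    exact idxOfSlot₂_clause 2 hc (by omega)

/-- **A base pair determines its gadget.** [folklore] -/
theorem idxOfSlot₂_basePair₂ {i : ℕ} (hi : i < n₂ φ) :
    idxOfSlot₂ φ (basePair₂ φ i).1 = i ∧ idxOfSlot₂ φ (basePair₂ φ i).2 = i := by
  unfold basePair₂
  split_ifs with h₁ h₂ h₃
  · obtain ⟨hc, hr, hh, -⟩ := hop_idx_lt h₁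
    have hj := J_lt (r := i / 5 % N φ) hc
    have hi5 : i / 5 / N φ * N φ + i / 5 % N φ = i / 5 := by rw [Nat.mul_comm]; exact Nat.div_add_mod _ _
    have hi' : 5 * (i / 5) + i % 5 = i := Nat.div_add_mod _ _
    unfold hopSlots
    split_ifs with h0 h4 <;> dsimp only
    · rw [idxOfSlot₂_above hr hc, idxOfSlot₂_hopUL hj (by omega), J_J hc]
      omega
    · rw [idxOfSlot₂_hopLL hj (by omega), idxOfSlot₂_wUL hr hj, J_J hc]
      omega
    · rw [idxOfSlot₂_hopLL hj (by omega), idxOfSlot₂_hopUL hj (by omega), J_J hc]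
      omega
  · obtain ⟨ha, hb⟩ := idxOfSlot₂_setSlots (φ := φ) (c := i - 5 * (N φ * N φ)) (by omega)
    rw [ha, hb]; omega
  · have hc : i - 5 * (N φ * N φ) < N φ := by omega
    obtain ⟨ha, -⟩ := idxOfSlot₂_setSlots (φ := φ) hc
    unfold setSlots at ha
    rw [if_neg h₃] at ha
    dsimp only at ha ⊢
    rw [ha, idxOfSlot₂_d'LL hc]; omega
  · obtain ⟨ha, hb⟩ := idxOfSlot₂_klinkSlots (φ := φ) (c := i - (5 * (N φ * N φ) + N φ)) (by unfold n₂ at hi; omega)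
    rw [ha, hb]; unfold n₂ at hi; omega

/-- **Every stage-2 slot has distinct ends, and its increasing form is a base pair of its gadget**:
so it has a stage-2 kind and determines its gadget. [folklore] -/
theorem slot₂_spec {i : ℕ} (hi : i < n₂ φ) {x : ℕ × ℕ} (hx : x ∈ (placed₂ φ i).S) :
    x.1 ≠ x.2 ∧ idxOfSlot₂ φ (canon x) = i ∧ Slot2Kind φ (canon x) := by
  have hok := slotPair₂_ok hi
  rw [placed₂_S hi, Finset.mem_insert, Finset.mem_singleton] at hx
  rcases hx with rfl | rfl
  · rw [(canon_slotPair₂ hi).1]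
    exact ⟨hok.1.1, (idxOfSlot₂_basePair₂ hi).1, (slot2Kind_basePair₂ hi).1⟩
  · rw [(canon_slotPair₂ hi).2]
    exact ⟨hok.2.1.1, (idxOfSlot₂_basePair₂ hi).2, (slot2Kind_basePair₂ hi).2⟩

/-- **A stage-2 slot with an end at or above `base1` is an (unreversed) hop edge, hence increasing.** [folklore] -/
theorem lt_of_mem_S₂_of_base1_le {i : ℕ} (hi : i < n₂ φ) {e : ℕ × ℕ} (he : e ∈ (placed₂ φ i).S) (h1 : base1 φ ≤ e.1) :
    e.1 < e.2 := by
  rw [placed₂_S hi, Finset.mem_insert, Finset.mem_singleton] at he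
  revert he
  unfold slotPair₂
  split_ifs with h₁ h₂ <;> intro he
  · obtain ⟨hc, hr, hh, -⟩ := hop_idx_lt h₁
    have hj := J_lt (r := i / 5 % N φ) hc
    revert he
    unfold hopSlots'
    split_ifs with h0 <;> intro he
    · rcases he with rfl | rfl
      · have := above_bounds hr hc
        simp only [Prod.fst_swap, Prod.snd_swap] at h1 ⊢; omega
      · exact (hopUL_bounds hr hj 0 (by omega)).1
    · revert he
      unfold hopSlots
      rw [if_neg h0]
      split_ifs with h4 <;> intro he <;> dsimp only at he <;> rcases he with rfl | rfl
      · exact (hopLL_bounds hr hj 3 (by omega)).1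
      · have := (cellSlot_bounds (φ := φ) (rowCell_lt_M hr (k := 2 * J φ (i / 5 % N φ) (i / 5 / N φ) + 1) (by omega))).1
        unfold wIdx at h1 ⊢; omega
      · exact (hopLL_bounds hr hj (i % 5 - 1) (by omega)).1
      · exact (hopUL_bounds hr hj (i % 5) (by omega)).1
  · have := setSlots'_lt_base1 (φ := φ) (c := i - 5 * (N φ * N φ)) (by omega)
    rcases he with rfl | rfl <;> omega
  · have hc : i - (5 * (N φ * N φ) + N φ) < N φ := by unfold n₂ at hi; omega
    have hb := below_bounds (φ := φ) (r := N φ - 1) (by omega) hc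
    have hk := (cellSlot_bounds (φ := φ) (kIdx_lt_M hc)).1
    revert he
    unfold klinkSlots'
    dsimp only
    rintro (rfl | rfl)
    · simp only [Prod.fst_swap] at h1; omega
    · omega

/-! ### Validity of stage 2 -/

/-- A site index is a stage-1 index. [folklore] -/
theorem site_lt_n₁ {r j : ℕ} (hr : r < N φ) (hj : j < N φ) : r * N φ + j < n₁ φ := by
  have : r * N φ + j < N φ * N φ := by
    calc r * N φ + j < r * N φ + N φ := by omega
      _ = (r + 1) * N φ := by ring
      _ ≤ N φ * N φ := Nat.mul_le_mul_right _ hr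
  unfold n₁; omega

/-- A pair of stage-2 kind is an edge of `graph₁` inside `verts₁`. [folklore] -/
theorem slot_ok_of_kind {e : ℕ × ℕ} (hK : Slot2Kind φ e) :
    e.1 ∈ verts₁ φ ∧ e.2 ∈ verts₁ φ ∧ (graph₁ φ).Adj e.1 e.2 := by
  rcases hK.chain_or_hop with ⟨h1, h2, hadj, hlt⟩ | ⟨r, j, hr, hj, hH⟩
  · refine ⟨GadgetFamily.mem_vertsUpTo_iff.2 (Or.inl h1), GadgetFamily.mem_vertsUpTo_iff.2 (Or.inl h2),
      Or.inl ⟨hadj, h1, h2, fun i' hi' hs => ?_⟩⟩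
    rcases hs with hs | hs <;> change _ ∈ (placed₁ φ i').S at hs <;> rw [placed₁_S] at hs
    · exact (hK.ne_slot1 hlt (slot1Kind_of_mem hi' hs)).1 rfl
    · exact (hK.ne_slot1 hlt (slot1Kind_of_mem hi' hs)).2 rfl
  · have hidx := site_lt_n₁ hr hj
    obtain ⟨h1, h2, hadj⟩ := (placed₁ φ (r * N φ + j)).H_inner e hH
    exact ⟨GadgetFamily.mem_vertsUpTo_iff.2 (Or.inr ⟨_, hidx, h1⟩),
      GadgetFamily.mem_vertsUpTo_iff.2 (Or.inr ⟨_, hidx, h2⟩), Or.inr ⟨_, hidx, hadj⟩⟩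

/-- **The stage-2 family is valid over the stage-1 graph.** [cite: GareyJohnson1979, §3.2.2; LiskiewiczOgiharaToda2003, §3] -/
theorem valid₂ : GadgetFamily.Valid (graph₁ φ) (verts₁ φ) (fam₂ φ) (n₂ φ) := by
  refine ⟨fun i hi => ?_, fun i hi j hj hij => ?_, fun i hi e he => ?_, fun i hi j hj hij e he => ?_,
    fun i _ => (placed₂ φ i).slot_disjoint, fun i _ => (placed₂ φ i).gadget_adj,
    fun i _ => (placed₂ φ i).port_unique, fun i _ => (placed₂ φ i).exclusive⟩
  · -- fresh
    rw [Finset.disjoint_left]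
    intro v hv hvX
    have h1 := ((placed₂ φ i).lo_le_of_mem hvX).1
    rw [(placed₂_lo hi).1] at h1
    have hb := base1_le_base2 (φ := φ)
    rcases GadgetFamily.mem_vertsUpTo_iff.1 hv with hv | ⟨i', hi', hv⟩
    · rw [chainV, Finset.mem_range] at hv
      unfold base1 at hb; omega
    · have h2 := (placed₁ φ i').lo_le_of_mem hv
      rw [placed₁_lo, placed₁_size] at h2
      have := lo₁_add_size_le_base2 (φ := φ) hi'
      omega
  · -- pairwise disjoint blocks
    rw [Finset.disjoint_left]
    intro v hvi hvj
    have h1 := (placed₂ φ i).lo_le_of_mem hvi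
    have h2 := (placed₂ φ j).lo_le_of_mem hvj
    rw [(placed₂_lo hi).1, (placed₂_lo hi).2] at h1
    rw [(placed₂_lo hj).1, (placed₂_lo hj).2] at h2
    rcases Nat.lt_or_gt_of_ne hij with h | h <;> omega
  · -- slots are edges of `graph₁` inside `verts₁` (proved for the increasing form, transferred)
    change e ∈ (placed₂ φ i).S at he
    obtain ⟨hne, -, hK⟩ := slot₂_spec hi he
    have hP := slot_ok_of_kind hK
    rcases canon_eq_or e with hc | hc
    · rw [hc] at hP; exact hP
    · rw [hc] at hP
      obtain ⟨h1, h2, hadj⟩ := hP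
      simp only [Prod.fst_swap, Prod.snd_swap] at h1 h2 hadj
      exact ⟨h2, h1, hadj.symm⟩
  · -- distinct gadgets, distinct slots in either orientation (through the increasing forms)
    change e ∈ (placed₂ φ i).S at he
    obtain ⟨hne, hidx, -⟩ := slot₂_spec hi he
    rintro (hs | hs) <;> change _ ∈ (placed₂ φ j).S at hs
    · exact hij (hidx.symm.trans (slot₂_spec hj hs).2.1)
    · have h := (slot₂_spec hj hs).2.1
      rw [show ((e.2, e.1) : ℕ × ℕ) = e.swap from rfl, canon_swap hne] at h
      exact hij (hidx.symm.trans h)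

end LOTReduction

end Literature.Combinatorics.SimpleGraph
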